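import Literature.NumberTheory.Rogawski1990.ArchSmoothAmbientLift                 -- ★ `ArchSmooth.exists_contDiff` (ambient smooth `Θ` on `M_N(L ⊗ ℝ)`)
import Literature.MeasureTheory.Group.QuotientOrbitalIntegralProperSmooth          -- brings the Hörmander engine ★ `Literature.Analysis.Calculus.contDiffAt_integral_comp_of_contDiff_of_support`
import Literature.NumberTheory.Automorphic.UnitaryGroupArchTopology                -- ★ instances `LocallyCompactSpace ∕ T2Space ∕ IsTopologicalGroup` on `arch …`
import HarnessLib

/-!
# (aM-SMOOTH): the cut-off-descended test function `m ↦ ∫_{G′_∞} β(x) a′(x m x⁻¹) dν′` of a smooth `a′` is SMOOTH in the ambient matrix of `m`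
# (Harish-Chandra's descent; Rogawski 1990 §4.12, §8.2 p. 114; Hörmander Thm. 1.1.9)

Topic `NumberTheory/Rogawski1990`; namespace `Literature.NumberTheory.Rogawski1990`.  THEOREMS ONLY (no `def`, no instance, no notation, no axiom, no named fact, no `sorry`).
Cell `pub/hodgecm-mathlib`, crux H413 (`stmt-HodgeConjecture-24833`), line LH3 (closer stub `stub_N9`, direct road), LETTER L1 `HcOrbitalFamiliesStatement` clause (I₂) at the
real walls, ALL ORDERS: the one analytic input (aM-SMOOTH) of the (B∞) dress «`ContDiffOn ℝ ∞ (orbFamGExt …) (InRegG s S′)` across the real walls» (★ (B) p850625∕p850640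
F0P3b-p01 (g15) at order 0; ★ (A0-smooth) p850603 the rank-one engine) — released to this seat (F0P3b-p01 2026-09-02T08:53:22Z, LH3-plan (g3) DEALER BOARD v3.6 «=»); seat
F0P3a-p05 (g20); count-neutral.

THE MATHEMATICS.  `G′_∞ = U(H)(L⁺ ⊗ ℝ) ≤ GL_N(L ⊗ ℝ)`, read in the ambient algebra `M_N(L ⊗ ℝ)` by `x ↦ ↑↑x`.  For `a′ ∈ C_c^∞(G′_∞)` (★ `ArchSmooth`: `a′ = Θ ∘ (↑↑·)` with `Θ` smooth on
`M_N(L ⊗ ℝ)`, ★ `ArchSmooth.exists_contDiff`) and a continuous compactly supported cut-off `β` (★ `ConjugationCutoff`), the descended function of ★ D4b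
`chartOrbG_eq_integral_descended_of_cutoff` is `(a′)_M^β(m) = ∫_{G′_∞} β(x) • a′(x m x⁻¹) dν′(x) = ΘM(↑↑m)` with
**`ΘM(X) := ∫_{G′_∞} β(x) • Θ(↑↑x · X · ↑↑x⁻¹) dν′(x)` SMOOTH ON ALL OF `M_N(L ⊗ ℝ)`** (`contDiff_integral_smul_comp_conj`): the integrand `b • Θ(A X C)` is smooth in
`((b, A, C), X)` and read at the continuous datum `(β x, ↑↑x, ↑↑x⁻¹)`, and it vanishes for `x ∉ tsupport β` whatever `X` — the Hörmander engine ★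
`Literature.Analysis.Calculus.contDiffAt_integral_comp_of_contDiff_of_support` with `S := tsupport β`, `U := univ`.  Readings: `exists_contDiff_integral_smul_conj_eq` (on `G′_∞`),
`exists_contDiff_descended_eq` (on any subgroup `M ≤ G′_∞`, the literal `aM` of ★ (J-G′-BLOCK)∕(B)).
HONEST LABEL: HC_CM is proved only modulo the printed citations (2 remaining named inputs: hLiu418 = `stmt-HodgeConjecture-24832`, h413 = `stmt-HodgeConjecture-24833`) until rung 0
closes; count-neutral plumbing.

## References
* [Rogawski1990] J. D. Rogawski, *Automorphic Representations of Unitary Groups in Three Variables*, Ann. of Math. Stud. 123 (1990), §4.12 Lemma 4.12.1 p. 66, §8.2 p. 114 (descent to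
  the centraliser with a cut-off).
* [HarishChandra1970] Harish-Chandra (notes by G. van Dijk), *Harmonic Analysis on Reductive p-adic Groups*, LNM 162 (1970), Part I §3 Lemmas 22–23.
* [HormanderALPDO1] L. Hörmander, *The Analysis of Linear Partial Differential Operators I* (1990), Thm. 1.1.9 (differentiation under the integral sign).
* [DeitmarEchterhoff2014] A. Deitmar, S. Echterhoff, *Principles of Harmonic Analysis*, 2nd ed. (2014), Lemma 9.3.3.
-/

set_option autoImplicit false

noncomputable section

open MeasureTheory Matrix NumberField NumberField.InfinitePlace NumberField.mixedEmbedding Set Function Topology Complex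
open scoped MatrixGroups ContDiff Classical
open scoped Matrix.Norms.Operator

namespace Literature.NumberTheory.Rogawski1990

open Literature.NumberTheory.Automorphic Literature.NumberTheory.Automorphic.UnitaryGroup

section Descended

variable (L : Type) [Field L] [NumberField L] [IsCMField L] (N : ℕ) (H : Matrix (Fin N) (Fin N) L)
  [MeasurableSpace ↥(arch (↥(maximalRealSubfield L)) L (IsCMField.complexConj L) N H)]
  [BorelSpace ↥(arch (↥(maximalRealSubfield L)) L (IsCMField.complexConj L) N H)]
  (ν' : Measure ↥(arch (↥(maximalRealSubfield L)) L (IsCMField.complexConj L) N H)) [IsFiniteMeasureOnCompacts ν']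
  {E : Type*} [NormedAddCommGroup E] [NormedSpace ℝ E] [CompleteSpace E]

/-- **THE `β`-AVERAGED CONJUGATE OF A SMOOTH AMBIENT FUNCTION IS SMOOTH**: for `Θ : M_N(L ⊗ ℝ) → E` smooth and a continuous compactly supported cut-off `β` on `G′_∞`,
`X ↦ ∫_{G′_∞} β(x) • Θ(↑↑x · X · ↑↑x⁻¹) dν′(x)` is `C^∞` on ALL of `M_N(L ⊗ ℝ)` (Hörmander: the integrand `b • Θ(A X C)` is smooth in `((b, A, C), X)` and read at the continuous datum
`(β x, ↑↑x, ↑↑x⁻¹)`; for `x ∉ tsupport β` it vanishes for every `X`). [cite: HormanderALPDO1, Thm. 1.1.9] [cite: DeitmarEchterhoff2014, Lemma 9.3.3] [cite: Rogawski1990, §8.2 p. 114] -/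
theorem contDiff_integral_smul_comp_conj (Θ : Matrix (Fin N) (Fin N) (mixedSpace L) → E) (hΘ : ContDiff ℝ ∞ Θ)
    (β : ↥(arch (↥(maximalRealSubfield L)) L (IsCMField.complexConj L) N H) → ℝ) (hβc : Continuous β) (hβs : HasCompactSupport β) :
    ContDiff ℝ ∞ fun X : Matrix (Fin N) (Fin N) (mixedSpace L) =>
      ∫ x, β x • Θ (((x : GL (Fin N) (mixedSpace L)) : Matrix (Fin N) (Fin N) (mixedSpace L)) * X *
        (((x⁻¹ : ↥(arch (↥(maximalRealSubfield L)) L (IsCMField.complexConj L) N H)) : GL (Fin N) (mixedSpace L)) : Matrix (Fin N) (Fin N) (mixedSpace L))) ∂ν' := by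
  let P := ℝ × Matrix (Fin N) (Fin N) (mixedSpace L) × Matrix (Fin N) (Fin N) (mixedSpace L)
  obtain ⟨Ψ, hΨ⟩ : ∃ Ψ : P × Matrix (Fin N) (Fin N) (mixedSpace L) → E, Ψ = fun w => w.1.1 • Θ (w.1.2.1 * w.2 * w.1.2.2) := ⟨_, rfl⟩
  have hΨs : ContDiff ℝ ∞ Ψ := by
    rw [hΨ]
    refine (contDiff_fst.comp contDiff_fst).smul (hΘ.comp ?_)
    exact (((contDiff_fst.comp (contDiff_snd.comp contDiff_fst)).mul contDiff_snd).mul (contDiff_snd.comp (contDiff_snd.comp contDiff_fst)))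
  obtain ⟨y, hy⟩ : ∃ y : ↥(arch (↥(maximalRealSubfield L)) L (IsCMField.complexConj L) N H) → P, y = fun x =>
      (β x, ((x : GL (Fin N) (mixedSpace L)) : Matrix (Fin N) (Fin N) (mixedSpace L)),
        (((x⁻¹ : ↥(arch (↥(maximalRealSubfield L)) L (IsCMField.complexConj L) N H)) : GL (Fin N) (mixedSpace L)) : Matrix (Fin N) (Fin N) (mixedSpace L))) := ⟨_, rfl⟩
  have hcoe : Continuous fun x : ↥(arch (↥(maximalRealSubfield L)) L (IsCMField.complexConj L) N H) =>
      ((x : GL (Fin N) (mixedSpace L)) : Matrix (Fin N) (Fin N) (mixedSpace L)) := Units.continuous_val.comp continuous_subtype_val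
  have hyc : Continuous y := by
    rw [hy]
    exact hβc.prodMk (hcoe.prodMk (hcoe.comp continuous_inv))
  have hEq : (fun X : Matrix (Fin N) (Fin N) (mixedSpace L) =>
      ∫ x, β x • Θ (((x : GL (Fin N) (mixedSpace L)) : Matrix (Fin N) (Fin N) (mixedSpace L)) * X *
        (((x⁻¹ : ↥(arch (↥(maximalRealSubfield L)) L (IsCMField.complexConj L) N H)) : GL (Fin N) (mixedSpace L)) : Matrix (Fin N) (Fin N) (mixedSpace L))) ∂ν') =
      fun X => ∫ x, Ψ (y x, X) ∂ν' := by
    rw [hΨ, hy]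
  rw [hEq]
  refine contDiff_iff_contDiffAt.2 fun X₀ => ?_
  refine Literature.Analysis.Calculus.contDiffAt_integral_comp_of_contDiff_of_support ν' Ψ hΨs y hyc X₀ hβs Filter.univ_mem ?_
  intro x hx X _
  rw [hΨ, hy]
  simp only [image_eq_zero_of_notMem_tsupport hx, zero_smul]

/-- **(aM-SMOOTH) — THE DESCENDED TEST FUNCTION IS SMOOTH IN AMBIENT CURRENCY.**  For `a′ ∈ C_c^∞(G′_∞)` (★ `ArchSmooth`) and a continuous compactly supported cut-off `β`,
there is a `C^∞` function `ΘM : M_N(L ⊗ ℝ) → ℂ` with **`∫_{G′_∞} β(x) • a′(x · m · x⁻¹) dν′(x) = ΘM(↑↑m)` for EVERY `m ∈ G′_∞`** — in particular for `m` in the centraliser `Z(s)`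
of a wall point, so the descended function `(a′)_M^β` of ★ D4b `chartOrbG_eq_integral_descended_of_cutoff` ∕ ★ (J-G′-BLOCK) is the restriction of a smooth ambient function
(the `hf`∕`hFf` input of ★ (A0-smooth) `ArchRankOneSplitOrbitSmooth` for the block function, modulo the matrix reading of the block equivalence). [cite: Rogawski1990, §4.12 Lemma 4.12.1 p. 66; §8.2 p. 114]
[cite: HormanderALPDO1, Thm. 1.1.9] [cite: HarishChandra1970, Part I §3 Lemmas 22–23] -/
theorem exists_contDiff_integral_smul_conj_eq {a' : ↥(arch (↥(maximalRealSubfield L)) L (IsCMField.complexConj L) N H) → ℂ} (ha' : ArchSmooth L N H a')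
    (β : ↥(arch (↥(maximalRealSubfield L)) L (IsCMField.complexConj L) N H) → ℝ) (hβc : Continuous β) (hβs : HasCompactSupport β) :
    ∃ ΘM : Matrix (Fin N) (Fin N) (mixedSpace L) → ℂ, ContDiff ℝ ∞ ΘM ∧
      ∀ m : ↥(arch (↥(maximalRealSubfield L)) L (IsCMField.complexConj L) N H),
        ∫ x, β x • a' (x * m * x⁻¹) ∂ν' = ΘM ((m : GL (Fin N) (mixedSpace L)) : Matrix (Fin N) (Fin N) (mixedSpace L)) := by
  obtain ⟨Θ, hΘ, -, -, hΘf⟩ := ha'.exists_contDiff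
  refine ⟨_, contDiff_integral_smul_comp_conj L N H ν' Θ hΘ β hβc hβs, fun m => ?_⟩
  refine integral_congr_ae (Filter.Eventually.of_forall fun x => ?_)
  simp only [hΘf, Subgroup.coe_mul, Units.val_mul]

/-- **(aM-SMOOTH) on a closed subgroup `M ≤ G′_∞`** (the form ★ D4b uses: `aM : ↥M → ℂ`, `aM m = ∫ β x • a′ (x * ↑m * x⁻¹)`): `aM = ΘM ∘ (↑↑↑·)` with `ΘM` smooth on
`M_N(L ⊗ ℝ)`. [cite: Rogawski1990, §4.12 Lemma 4.12.1 p. 66; §8.2 p. 114] [cite: HormanderALPDO1, Thm. 1.1.9] -/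
theorem exists_contDiff_descended_eq {a' : ↥(arch (↥(maximalRealSubfield L)) L (IsCMField.complexConj L) N H) → ℂ} (ha' : ArchSmooth L N H a')
    (β : ↥(arch (↥(maximalRealSubfield L)) L (IsCMField.complexConj L) N H) → ℝ) (hβc : Continuous β) (hβs : HasCompactSupport β)
    (M : Subgroup ↥(arch (↥(maximalRealSubfield L)) L (IsCMField.complexConj L) N H)) :
    ∃ ΘM : Matrix (Fin N) (Fin N) (mixedSpace L) → ℂ, ContDiff ℝ ∞ ΘM ∧
      (fun m : ↥M => ∫ x, β x • a' (x * (m : ↥(arch (↥(maximalRealSubfield L)) L (IsCMField.complexConj L) N H)) * x⁻¹) ∂ν') =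
        fun m : ↥M => ΘM ((((m : ↥M) : ↥(arch (↥(maximalRealSubfield L)) L (IsCMField.complexConj L) N H)) : GL (Fin N) (mixedSpace L)) : Matrix (Fin N) (Fin N) (mixedSpace L)) := by
  obtain ⟨ΘM, hΘM, h⟩ := exists_contDiff_integral_smul_conj_eq L N H ν' ha' β hβc hβs
  exact ⟨ΘM, hΘM, funext fun m => h m⟩

end Descended

end Literature.NumberTheory.Rogawski1990

end
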